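import Summits.Ventures.Crystal3D.Bulk.L2bTransfer
import Summits.Ventures.Crystal3D.Bulk.L2bBarlow
import Literature.Geometry.DiscreteGeometry.LayerStackings
import Summits.Ventures.Crystal3D.Bulk.LocalTwelveOfHales
import Summits.Ventures.Crystal3D.Bulk.PositionalOrder
import HarnessLib

/-!
# The radius-2 lemma `RadiusTwoBarlow` PROVED — positional order is a corollary of the first-shell count

HONEST FRAMING. Part of the venture `Summits/Ventures/Crystal3D` (cell `pub-crystal3d`, phase 2). This
file DISCHARGES the venture's named finite hypothesis `RadiusTwoBarlow` («L2B», `Bulk/PositionalOrder.lean`;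
previously certified only by the cell's exhaustive exact computation outside the kernel,
`step0/max13/cpshell/CPEXT-RESULT.md` §8) by a census-free structural proof in the kernel (bricks
`Bulk/L2bHexagonSteps`, `L2bFrames`, `L2bTables`, `L2bTransfer`, `L2bBarlow`; design `HOME/lean/l2b/DESIGN.md`).
Consequently `positionalOrder_of_bulk` holds with NO named hypothesis besides `BulkCrystallization3D K`
itself (`positionalOrder_of_bulk'`). Nothing here touches the census, GAP(1.26), or `BulkCrystallization3D`.

## Contents
Part 1 (namespace `…Crystal3D.L2B`): `hexagon_shell_of_fcc`, `ring_of_fcc` (the six hexagon balls of an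
FCC-interlocked centre have the centre's layer shell), `cp1_moved` / `cp2_moved`, **`exists_adapted_frame`**
(MAIN FRAME LEMMA: after an isometry the centre's shell is a layer shell and so are the six hexagon balls';
cases: centre HCP-type — its own frame; FCC-type with an HCP-type neighbour — that neighbour's frame, hexagon
transfer, STEP B `ring_not_hcp`; FCC-type with FCC-type neighbours only — any FCC frame).
Part 2 (namespace `…Crystal3D`): scaling of `barlowStacking`, **`radiusTwoBarlow_holds : RadiusTwoBarlow`**,
`positionalOrder_of_bulk'`, `card_nonBarlowCentre_le'`, `positionalOrder_of_hales` (in-print route, std axioms).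

## Proof sketch: an HCP-type shell keeps its mirror plane along its mirror hexagon (local Hales §1.3 steps);
for an FCC-type centre an HCP-type neighbour's mirror plane is a face plane of the cuboctahedron, the centre's
shell contains the parallel hexagon, and two HCP faces of different families would give a second-shell ball two
mirror planes (witness lemma); so all thirteen shells are layer shells = the stacking's tangent arrangements.
-/

noncomputable section

namespace Summit.Ventures.Crystal3D.L2B

open Literature.Geometry.DiscreteGeometry Literature.MathematicalPhysics.StatisticalMechanics
open RealInnerProductSpace

variable {V : Set (EuclideanSpace ℝ (Fin 3))}

/-- One FCC-type hexagon ball: its shell contains the standard hexagon (Hales's interlocking, local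
form) and is therefore a layer shell. -/
theorem hexagon_shell_of_fcc (hV : IsUnitBallPacking V) (h0 : (0 : EuclideanSpace ℝ (Fin 3)) ∈ V)
    {σ σ' : ℝ} (hS0 : kissingShell V 0 = layerShell σ σ') {η η' : EuclideanSpace ℝ (Fin 3)}
    (hη : ⟪η, η⟫ = 4) (hη' : ⟪η', η'⟫ = 4) (hηη' : ⟪η, η'⟫ = 2)
    (hhex : hexagonSet = ({η, -η, η', -η', η - η', η' - η} : Set (EuclideanSpace ℝ (Fin 3))))
    (hfcc : IsArrangedIn (kissingShell V η) fccKissingPattern) :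
    ∃ τ τ' : ℝ, (τ = 1 ∨ τ = -1) ∧ (τ' = 1 ∨ τ' = -1) ∧ kissingShell V η = layerShell τ τ' := by
  have hH0 : hexagonSet ⊆ kissingShell V 0 := hS0 ▸ hexagonSet_subset_layerShell σ σ'
  have m1 : η ∈ kissingShell V 0 := hH0 (by rw [hhex]; simp)
  have m2 : η' ∈ kissingShell V 0 := hH0 (by rw [hhex]; simp)
  have m3 : η - η' ∈ kissingShell V 0 := hH0 (by rw [hhex]; simp)
  have hsub := hexagon_subset_kissingShell_add_of_fcc_local hη hη' hηη' h0 m1 m2 m3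
    (by rw [zero_add]; exact hfcc)
  rw [zero_add, ← hhex] at hsub
  exact (isTwelveConfig_kissingShell_of_isArrangedIn hV (Or.inl hfcc)).eq_layerShell hsub

/-- **The ring of an FCC-interlocked centre.** If the shell of `0 ∈ V` is `layerShell σ σ'` and the six
hexagon balls have FCC tangent arrangements, then each of them has shell `layerShell σ σ'`. -/
theorem ring_of_fcc (hV : IsUnitBallPacking V) (h0 : (0 : EuclideanSpace ℝ (Fin 3)) ∈ V) {σ σ' : ℝ}
    (hσ : σ = 1 ∨ σ = -1) (hσ' : σ' = 1 ∨ σ' = -1) (hS0 : kissingShell V 0 = layerShell σ σ')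
    (hfcc : ∀ η ∈ hexagonSet, IsArrangedIn (kissingShell V η) fccKissingPattern) :
    ∀ η ∈ hexagonSet, kissingShell V η = layerShell σ σ' := by
  -- `u₁`
  obtain ⟨τu, τu', hτu, hτu', hSu⟩ := hexagon_shell_of_fcc hV h0 hS0 (η := triangularVec₁ (2 : ℝ))
    (η' := triangularVec₂ (2 : ℝ)) (by norm_num) (by norm_num) (by norm_num) hexagonSet_eq_uv
    (hfcc _ (by simp [hexagonSet]))
  obtain ⟨eu, eu'⟩ := types_eq_of_adjacent hV (P := 0) (Or.inl rfl) hσ hσ' hτu hτu' hS0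
    (by rw [zero_add]; exact hSu)
  subst eu eu'
  -- `u₂`
  obtain ⟨τv, τv', hτv, hτv', hSv⟩ := hexagon_shell_of_fcc hV h0 hS0 (η := triangularVec₂ (2 : ℝ))
    (η' := triangularVec₁ (2 : ℝ)) (by norm_num) (by norm_num) (by norm_num) hexagonSet_eq_vu
    (hfcc _ (by simp [hexagonSet]))
  obtain ⟨ev, ev'⟩ := types_eq_of_adjacent hV (P := 0) (Or.inr rfl) hσ hσ' hτv hτv' hS0
    (by rw [zero_add]; exact hSv)
  subst ev ev'
  -- `-u₁`
  obtain ⟨τa, τa', hτa, hτa', hSa⟩ := hexagon_shell_of_fcc hV h0 hS0 (η := -triangularVec₁ (2 : ℝ))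
    (η' := -triangularVec₂ (2 : ℝ)) (by norm_num) (by norm_num) (by norm_num) hexagonSet_eq_nu_nv
    (hfcc _ (by simp [hexagonSet]))
  obtain ⟨ea, ea'⟩ := types_eq_of_adjacent hV (P := -triangularVec₁ (2 : ℝ)) (Or.inl rfl) hτa hτa'
    hσ hσ' hSa (by rw [neg_add_cancel]; exact hS0)
  subst ea ea'
  -- `-u₂`
  obtain ⟨τb, τb', hτb, hτb', hSb⟩ := hexagon_shell_of_fcc hV h0 hS0 (η := -triangularVec₂ (2 : ℝ))
    (η' := -triangularVec₁ (2 : ℝ)) (by norm_num) (by norm_num) (by norm_num) hexagonSet_eq_nv_nu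
    (hfcc _ (by simp [hexagonSet]))
  obtain ⟨eb, eb'⟩ := types_eq_of_adjacent hV (P := -triangularVec₂ (2 : ℝ)) (Or.inr rfl) hτb hτb'
    hτa hτa' hSb (by rw [neg_add_cancel]; exact hS0)
  subst eb eb'
  -- `u₁ - u₂`
  obtain ⟨τc, τc', hτc, hτc', hSc⟩ := hexagon_shell_of_fcc hV h0 hS0
    (η := triangularVec₁ (2 : ℝ) - triangularVec₂ (2 : ℝ)) (η' := -triangularVec₂ (2 : ℝ))
    inner_self_frameU_sub_frameV (by norm_num) (by norm_num [inner_sub_left]) hexagonSet_eq_umv_nv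
    (hfcc _ (by simp [hexagonSet]))
  obtain ⟨ec, ec'⟩ := types_eq_of_adjacent hV (P := triangularVec₁ (2 : ℝ) - triangularVec₂ (2 : ℝ))
    (Or.inr rfl) hτc hτc' hτb hτb' hSc (by rw [sub_add_cancel]; exact hSu)
  subst ec ec'
  -- `u₂ - u₁`
  obtain ⟨τd, τd', hτd, hτd', hSd⟩ := hexagon_shell_of_fcc hV h0 hS0
    (η := triangularVec₂ (2 : ℝ) - triangularVec₁ (2 : ℝ)) (η' := -triangularVec₁ (2 : ℝ))
    inner_self_frameV_sub_frameU (by norm_num) (by norm_num [inner_sub_left]) hexagonSet_eq_vmu_nu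
    (hfcc _ (by simp [hexagonSet]))
  obtain ⟨ed, ed'⟩ := types_eq_of_adjacent hV (P := triangularVec₂ (2 : ℝ) - triangularVec₁ (2 : ℝ))
    (Or.inl rfl) hτd hτd' hτc hτc' hSd (by rw [sub_add_cancel]; exact hSv)
  subst ed ed'
  intro η hη
  simp only [hexagonSet, Set.mem_insert_iff, Set.mem_singleton_iff] at hη
  rcases hη with rfl | rfl | rfl | rfl | rfl | rfl <;> assumption

section Frame

variable (x : EuclideanSpace ℝ (Fin 3)) (L : EuclideanSpace ℝ (Fin 3) ≃ₗᵢ[ℝ] EuclideanSpace ℝ (Fin 3))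

/-- Neighbours' tangent arrangements, moved into the frame `y ↦ x + L y`. -/
theorem cp1_moved
    (hcp1 : ∀ c ∈ kissingShell V x, IsArrangedIn (kissingShell V (x + c)) fccKissingPattern ∨
      IsArrangedIn (kissingShell V (x + c)) hcpKissingPattern) :
    ∀ c ∈ kissingShell {y | x + L y ∈ V} 0,
      IsArrangedIn (kissingShell {y | x + L y ∈ V} c) fccKissingPattern ∨
        IsArrangedIn (kissingShell {y | x + L y ∈ V} c) hcpKissingPattern := by
  intro c hc
  rw [kissingShell_moved, map_zero, add_zero] at hc
  rw [kissingShell_moved]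
  exact (hcp1 (L c) hc).imp (fun h => h.preimage L) (fun h => h.preimage L)

/-- Second-shell tangent arrangements, moved into the frame `y ↦ x + L y`. -/
theorem cp2_moved
    (hcp2 : ∀ c ∈ kissingShell V x, ∀ y ∈ kissingShell V (x + c),
      IsArrangedIn (kissingShell V (x + c + y)) fccKissingPattern ∨
        IsArrangedIn (kissingShell V (x + c + y)) hcpKissingPattern) :
    ∀ c ∈ kissingShell {y | x + L y ∈ V} 0, ∀ y ∈ kissingShell {y | x + L y ∈ V} c,
      IsArrangedIn (kissingShell {y | x + L y ∈ V} (c + y)) fccKissingPattern ∨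
        IsArrangedIn (kissingShell {y | x + L y ∈ V} (c + y)) hcpKissingPattern := by
  intro c hc y hy
  rw [kissingShell_moved, map_zero, add_zero] at hc
  rw [kissingShell_moved] at hy
  rw [kissingShell_moved, map_add, ← add_assoc]
  exact (hcp2 (L c) hc (L y) hy).imp (fun h => h.preimage L) (fun h => h.preimage L)

end Frame

/-! ## The main frame lemma -/

/-- **MAIN FRAME LEMMA.** Let `x ∈ V` have an FCC or HCP tangent arrangement, and likewise every
neighbour `x + c` of `x` and every neighbour `x + c + y` of a neighbour. Then there is a linear isometry
`L` such that, in the moved packing `{y | x + L y ∈ V}`, the shell of `0` is a layer shell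
`layerShell σ σ'` (`σ, σ' = ±1`) and each of the six hexagon balls `η ∈ hexagonSet` has the same shell
`layerShell σ σ'`. -/
theorem exists_adapted_frame (hV : IsUnitBallPacking V) {x : EuclideanSpace ℝ (Fin 3)} (hx : x ∈ V)
    (hcp0 : IsArrangedIn (kissingShell V x) fccKissingPattern ∨
      IsArrangedIn (kissingShell V x) hcpKissingPattern)
    (hcp1 : ∀ c ∈ kissingShell V x, IsArrangedIn (kissingShell V (x + c)) fccKissingPattern ∨
      IsArrangedIn (kissingShell V (x + c)) hcpKissingPattern)
    (hcp2 : ∀ c ∈ kissingShell V x, ∀ y ∈ kissingShell V (x + c),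
      IsArrangedIn (kissingShell V (x + c + y)) fccKissingPattern ∨
        IsArrangedIn (kissingShell V (x + c + y)) hcpKissingPattern) :
    ∃ L : EuclideanSpace ℝ (Fin 3) ≃ₗᵢ[ℝ] EuclideanSpace ℝ (Fin 3), ∃ σ σ' : ℝ,
      (σ = 1 ∨ σ = -1) ∧ (σ' = 1 ∨ σ' = -1) ∧
      kissingShell {y | x + L y ∈ V} 0 = layerShell σ σ' ∧
      ∀ η ∈ hexagonSet, kissingShell {y | x + L y ∈ V} η = layerShell σ σ' := by
  by_cases hxh : IsArrangedIn (kissingShell V x) hcpKissingPattern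
  · -- (i) `x` is HCP-type: its own frame
    obtain ⟨L, s, hs, hS0⟩ := exists_hcp_frame hV hxh
    have hW : IsUnitBallPacking {y | x + L y ∈ V} := hV.preimage x L
    have h0 : (0 : EuclideanSpace ℝ (Fin 3)) ∈ {y | x + L y ∈ V} := by simpa using hx
    refine ⟨L, s, s, hs, hs, hS0, fun η hη => ?_⟩
    have hηS : η ∈ kissingShell {y | x + L y ∈ V} 0 := hS0 ▸ hexagonSet_subset_layerShell s s hη
    have h := (kissingShell_add_eq_layerShell_of_hcp_hexagon hW hs h0 hS0 hη
      (by rw [zero_add]; exact cp1_moved x L hcp1 η hηS)).2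
    rwa [zero_add] at h
  have hxf : IsArrangedIn (kissingShell V x) fccKissingPattern := hcp0.resolve_right hxh
  by_cases hex : ∃ c ∈ kissingShell V x, IsArrangedIn (kissingShell V (x + c)) hcpKissingPattern
  · -- (ii) an HCP-type neighbour `x + c₀`: its frame, re-centred at `x`
    obtain ⟨c₀, hc₀, hhcp⟩ := hex
    obtain ⟨L, s, hs, hSp⟩ := exists_hcp_frame hV hhcp
    have hW : IsUnitBallPacking {y | x + L y ∈ V} := hV.preimage x L
    have h0 : (0 : EuclideanSpace ℝ (Fin 3)) ∈ {y | x + L y ∈ V} := by simpa using hx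
    have cpW1 := cp1_moved x L hcp1
    have cpW2 := cp2_moved x L hcp2
    have hS0pre : kissingShell {y | x + L y ∈ V} 0 = L ⁻¹' kissingShell V x := by
      rw [kissingShell_moved]; simp
    have hfcc0 : IsArrangedIn (kissingShell {y | x + L y ∈ V} 0) fccKissingPattern := by
      rw [hS0pre]; exact hxf.preimage L
    have hnot : ¬ IsArrangedIn (kissingShell {y | x + L y ∈ V} 0) hcpKissingPattern := fun h' => by
      obtain ⟨A, hA⟩ := isArrangedIn_hcp_iff_range.1 h'
      exact not_centrallySymmetric_of_hcp_range hA fun z hz => neg_mem_of_fcc hfcc0 hz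
    -- the HCP neighbour in the frame
    set d : EuclideanSpace ℝ (Fin 3) := L.symm c₀ with hd_def
    have hd : d ∈ kissingShell {y | x + L y ∈ V} 0 := by rw [hS0pre]; simpa [hd_def] using hc₀
    have hdV : d ∈ {y | x + L y ∈ V} := by simpa using hd.1
    have hSd : kissingShell {y | x + L y ∈ V} d = layerShell s s := by
      rw [← hSp, kissingShell_moved, kissingShell_moved, map_zero, add_zero, hd_def,
        LinearIsometryEquiv.apply_symm_apply]
    have hdhcp : IsArrangedIn (kissingShell {y | x + L y ∈ V} d) hcpKissingPattern := by
      rw [hSd]; exact isArrangedIn_layerShell_hcp' hs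
    -- its mirror plane misses the centre
    have hdnot : d ∉ kissingShell {y | x + L y ∈ V} d := by
      intro h1
      have h2 : -d ∈ kissingShell {y | x + L y ∈ V} d :=
        ⟨by simpa using h0, by rw [norm_neg]; exact hd.2⟩
      have h3 := kissingShell_add_eq_of_hcp hW hdV hdhcp h2 (by rw [neg_neg]; exact h1)
        (by rw [add_neg_cancel]; exact Or.inl hfcc0)
      rw [add_neg_cancel] at h3
      exact hnot (h3 ▸ hdhcp)
    -- hexagon transfer: the centre's shell contains the standard hexagon
    have hH : hexagonSet ⊆ kissingShell {y | x + L y ∈ V} 0 := by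
      intro y hy
      obtain ⟨h1, h2⟩ := (mirror_iff_hexagon hs hSd).2 hy
      refine hexagon_transfer hW h0 (by simpa using hd) hdhcp (by simpa using hdnot) ?_ h1 h2
      intro z hz _
      exact cpW2 d hd z hz
    obtain ⟨σ, σ', hσ, hσ', hS0⟩ :=
      (isTwelveConfig_kissingShell_of_isArrangedIn hW (Or.inl hfcc0)).eq_layerShell hH
    have hσσ : σ' = -σ := by
      rcases hσ with rfl | rfl <;> rcases hσ' with rfl | rfl
      · exact absurd (hS0 ▸ isArrangedIn_layerShell_hcp' (σ := 1) (Or.inl rfl)) hnot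
      · norm_num
      · norm_num
      · exact absurd (hS0 ▸ isArrangedIn_layerShell_hcp' (σ := -1) (Or.inr rfl)) hnot
    subst hσσ
    have hdH : d ∉ hexagonSet := fun h => hdnot (hSd ▸ hexagonSet_subset_layerShell s s h)
    -- STEP B: the hexagon balls are FCC-type
    have hring : ∀ η ∈ hexagonSet,
        IsArrangedIn (kissingShell {y | x + L y ∈ V} η) fccKissingPattern := by
      intro η hη
      have hηS : η ∈ kissingShell {y | x + L y ∈ V} 0 := hS0 ▸ hexagonSet_subset_layerShell _ _ hη
      exact (cpW1 η hηS).resolve_right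
        (ring_not_hcp hW h0 hσ hS0 hd hdH hs hSd cpW1 cpW2 hη)
    exact ⟨L, σ, -σ, hσ, hσ', hS0, ring_of_fcc hW h0 hσ hσ' hS0 hring⟩
  · -- (iii) all neighbours FCC-type: any FCC frame
    push Not at hex
    obtain ⟨L, hHpre⟩ := exists_frame_of_isArrangedIn_fcc hxf
    have hW : IsUnitBallPacking {y | x + L y ∈ V} := hV.preimage x L
    have h0 : (0 : EuclideanSpace ℝ (Fin 3)) ∈ {y | x + L y ∈ V} := by simpa using hx
    have cpW1 := cp1_moved x L hcp1
    have hS0pre : kissingShell {y | x + L y ∈ V} 0 = L ⁻¹' kissingShell V x := by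
      rw [kissingShell_moved]; simp
    have hfcc0 : IsArrangedIn (kissingShell {y | x + L y ∈ V} 0) fccKissingPattern := by
      rw [hS0pre]; exact hxf.preimage L
    obtain ⟨σ, σ', hσ, hσ', hS0⟩ :=
      (isTwelveConfig_kissingShell_of_isArrangedIn hW (Or.inl hfcc0)).eq_layerShell (hS0pre ▸ hHpre)
    have hring : ∀ η ∈ hexagonSet,
        IsArrangedIn (kissingShell {y | x + L y ∈ V} η) fccKissingPattern := by
      intro η hη
      have hηS : η ∈ kissingShell {y | x + L y ∈ V} 0 := hS0 ▸ hexagonSet_subset_layerShell _ _ hη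
      have hLη : L η ∈ kissingShell V x := by rw [hS0pre] at hηS; exact hηS
      refine (cpW1 η hηS).resolve_right fun hh => hex (L η) hLη ?_
      have hh' := hh.preimage L.symm
      rw [kissingShell_moved] at hh'
      have e : L.symm ⁻¹' (L ⁻¹' kissingShell V (x + L η)) = kissingShell V (x + L η) := by
        ext z; simp
      rwa [e] at hh'
    exact ⟨L, σ, σ', hσ, hσ', hS0, ring_of_fcc hW h0 hσ hσ' hS0 hring⟩

end Summit.Ventures.Crystal3D.L2B

namespace Summit.Ventures.Crystal3D

open Literature.Geometry.DiscreteGeometry Literature.MathematicalPhysics.StatisticalMechanics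
open RealInnerProductSpace Summit.Ventures.Crystal3D.L2B

variable {N : ℕ}

/-- `barlowPos 2 (2√(2/3)) s = 2 • barlowPos 1 √(2/3) s`. -/
theorem barlowPos_two_eq_two_smul (s : ℤ → ℤ) (k i j : ℤ) :
    barlowPos 2 layerSpacing s k i j = (2 : ℝ) • barlowPos 1 (Real.sqrt (2 / 3)) s k i j := by
  ext m
  fin_cases m <;>
    simp [barlowPos, triangularVec₁, triangularVec₂, barlowOffset, layerNormal, layerSpacing] <;> ring

/-- Membership in the spacing-`1` stacking is membership of the doubled point in the spacing-`2`
stacking. -/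
theorem mem_barlowStacking_one_iff (s : ℤ → ℤ) (y : EuclideanSpace ℝ (Fin 3)) :
    y ∈ barlowStacking 1 (Real.sqrt (2 / 3)) s ↔ (2 : ℝ) • y ∈ barlowStacking 2 layerSpacing s := by
  constructor
  · rintro ⟨k, i, j, h⟩
    exact ⟨k, i, j, by rw [h, barlowPos_two_eq_two_smul]⟩
  · rintro ⟨k, i, j, h⟩
    refine ⟨k, i, j, ?_⟩
    rw [barlowPos_two_eq_two_smul] at h
    exact smul_right_injective _ (two_ne_zero' ℝ) h

/-! ## The radius-2 lemma -/

/-- Touching doubled centres are at distance `2`. -/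
theorem norm_two_smul_sub {x : Fin N → EuclideanSpace ℝ (Fin 3)} {i j : Fin N}
    (h : j ∈ contactNeighbors x i) : ‖(2 : ℝ) • x j - (2 : ℝ) • x i‖ = 2 := by
  rw [← smul_sub, norm_smul, Real.norm_of_nonneg zero_le_two, ← dist_eq_norm, dist_comm,
    ((mem_contactNeighbors x).1 h).2, mul_one]

/-- **The radius-2 lemma (L2B) holds**: in every finite packing of unit-diameter balls in `ℝ³`, a ball
all of whose contact-distance-`≤ 2` neighbourhood (itself included) consists of balls with close-packed
first shells is the centre of a Barlow radius-2 patch. -/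
theorem radiusTwoBarlow_holds : RadiusTwoBarlow := by
  intro N x hx i hcp
  have hV : IsUnitBallPacking (Set.range fun j => (2 : ℝ) • x j) := isUnitBallPacking_range_two_smul hx
  have hX : (2 : ℝ) • x i ∈ Set.range fun j => (2 : ℝ) • x j := ⟨i, rfl⟩
  -- a shell vector of `2 xᵢ` points to a doubled contact neighbour
  have nbr : ∀ {a : Fin N} {c : EuclideanSpace ℝ (Fin 3)},
      c ∈ kissingShell (Set.range fun j => (2 : ℝ) • x j) ((2 : ℝ) • x a) →
      ∃ b ∈ contactNeighbors x a, (2 : ℝ) • x a + c = (2 : ℝ) • x b := by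
    intro a c hc
    refine exists_eq_two_smul_of_dist_eq_two hc.1 ?_
    rw [dist_eq_norm, add_sub_cancel_left]; exact hc.2
  -- the tangent-arrangement hypotheses in Hales's normalisation
  have cpX : IsArrangedIn (kissingShell (Set.range fun j => (2 : ℝ) • x j) ((2 : ℝ) • x i))
      fccKissingPattern ∨ IsArrangedIn (kissingShell (Set.range fun j => (2 : ℝ) • x j)
      ((2 : ℝ) • x i)) hcpKissingPattern := by
    rw [kissingShell_range_two_smul]; exact hcp i (Or.inl rfl)
  have cp1 : ∀ c ∈ kissingShell (Set.range fun j => (2 : ℝ) • x j) ((2 : ℝ) • x i),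
      IsArrangedIn (kissingShell (Set.range fun j => (2 : ℝ) • x j) ((2 : ℝ) • x i + c))
        fccKissingPattern ∨ IsArrangedIn (kissingShell (Set.range fun j => (2 : ℝ) • x j)
        ((2 : ℝ) • x i + c)) hcpKissingPattern := by
    intro c hc
    obtain ⟨j, hj, hjc⟩ := nbr hc
    rw [hjc, kissingShell_range_two_smul]
    exact hcp j (Or.inr (Or.inl hj))
  have cp2 : ∀ c ∈ kissingShell (Set.range fun j => (2 : ℝ) • x j) ((2 : ℝ) • x i),
      ∀ y ∈ kissingShell (Set.range fun j => (2 : ℝ) • x j) ((2 : ℝ) • x i + c),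
      IsArrangedIn (kissingShell (Set.range fun j => (2 : ℝ) • x j) ((2 : ℝ) • x i + c + y))
        fccKissingPattern ∨ IsArrangedIn (kissingShell (Set.range fun j => (2 : ℝ) • x j)
        ((2 : ℝ) • x i + c + y)) hcpKissingPattern := by
    intro c hc y hy
    obtain ⟨j, hj, hjc⟩ := nbr hc
    rw [hjc] at hy ⊢
    obtain ⟨k, hk, hky⟩ := nbr hy
    rw [hky, kissingShell_range_two_smul]
    exact hcp k (Or.inr (Or.inr ⟨j, hj, hk⟩))
  -- the adapted frame and the stacking
  obtain ⟨L, σ, σ', hσ, hσ', hS0, hring⟩ := exists_adapted_frame hV hX cpX cp1 cp2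
  have hW : IsUnitBallPacking {y | (2 : ℝ) • x i + L y ∈ Set.range fun j => (2 : ℝ) • x j} :=
    hV.preimage _ L
  have h0 : (0 : EuclideanSpace ℝ (Fin 3)) ∈
      {y | (2 : ℝ) • x i + L y ∈ Set.range fun j => (2 : ℝ) • x j} := by simp
  obtain ⟨s, hs, hpatch⟩ :=
    patch_subset_barlowStacking hW h0 hσ hσ' hS0 hring (cp1_moved _ L cp1)
  refine ⟨s, hs, (IsometryEquiv.addRight (-x i)).trans L.symm.toIsometryEquiv, fun j hj => ?_⟩
  rw [mem_barlowStacking_one_iff]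
  have e : (2 : ℝ) • (((IsometryEquiv.addRight (-x i)).trans L.symm.toIsometryEquiv) (x j)) =
      L.symm ((2 : ℝ) • x j - (2 : ℝ) • x i) := by
    show (2 : ℝ) • L.symm (x j + -x i) = L.symm ((2 : ℝ) • x j - (2 : ℝ) • x i)
    rw [← map_smul, smul_add, smul_neg, sub_eq_add_neg]
  rw [e]
  apply hpatch
  -- the ball `j` in the frame lies in the radius-2 patch
  have shellW : ∀ {a b : Fin N}, b ∈ contactNeighbors x a →
      L.symm ((2 : ℝ) • x b - (2 : ℝ) • x i) - L.symm ((2 : ℝ) • x a - (2 : ℝ) • x i) ∈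
        kissingShell {y | (2 : ℝ) • x i + L y ∈ Set.range fun j => (2 : ℝ) • x j}
          (L.symm ((2 : ℝ) • x a - (2 : ℝ) • x i)) := by
    intro a b hab
    refine ⟨?_, ?_⟩
    · show (2 : ℝ) • x i + L (L.symm ((2 : ℝ) • x a - (2 : ℝ) • x i) +
        (L.symm ((2 : ℝ) • x b - (2 : ℝ) • x i) - L.symm ((2 : ℝ) • x a - (2 : ℝ) • x i))) ∈
        Set.range fun j => (2 : ℝ) • x j
      rw [add_sub_cancel, LinearIsometryEquiv.apply_symm_apply, add_sub_cancel]
      exact ⟨b, rfl⟩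
    · rw [← map_sub, LinearIsometryEquiv.norm_map, sub_sub_sub_cancel_right]
      exact norm_two_smul_sub hab
  rcases hj with rfl | hj | ⟨k, hk, hjk⟩
  · exact Or.inl (by simp)
  · right; left
    have h := shellW hj
    rwa [sub_self, map_zero, sub_zero] at h
  · right; right
    refine ⟨L.symm ((2 : ℝ) • x k - (2 : ℝ) • x i), ?_, shellW hjk⟩
    have h := shellW hk
    rwa [sub_self, map_zero, sub_zero] at h

/-- **Positional order from the first-shell count, unconditionally in the radius-2 lemma**: if all
but `K · N^{2/3}` balls of every sticky ground state have close-packed first shells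
(`BulkCrystallization3D K`), then all but `157 · K · N^{2/3}` balls of every sticky ground state are
centres of Barlow radius-2 patches (the ball, its contact neighbours and their contact neighbours are
carried by one isometry of `ℝ³` into one Barlow stacking). -/
theorem positionalOrder_of_bulk' {K : ℝ} (hK : BulkCrystallization3D K)
    (x : Fin N → EuclideanSpace ℝ (Fin 3)) (hx : IsStickyGroundState x) :
    ((nonBarlowCentre x).card : ℝ) ≤ 157 * K * (N : ℝ) ^ ((2 : ℝ) / 3) :=
  positionalOrder_of_bulk hK radiusTwoBarlow_holds x hx

/-- Counting form, unconditionally: in every unit packing the balls that are not centres of Barlow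
radius-2 patches number at most `157` times the balls without a close-packed first shell. -/
theorem card_nonBarlowCentre_le' {x : Fin N → EuclideanSpace ℝ (Fin 3)} (hx : IsUnitPacking x) :
    (nonBarlowCentre x).card ≤ 157 * (nonClosePacked x).card :=
  card_nonBarlowCentre_le hx radiusTwoBarlow_holds

/-- **W-2P on Hales's in-print route, standard axioms**: from the two named facts of Hales 2012 as
vendored in the tree (`flyspeck_L12`, Lemma 1, HOL-Light; `Hales2012_kissingConfigCongruent`,
Lemmas 9–10) — all but `157 · 1296 · N^{2/3}` balls of every sticky ground state of `N` unit spheres are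
centres of Barlow radius-2 patches. -/
theorem positionalOrder_of_hales (hL12 : flyspeck_L12) (hcl : Hales2012_kissingConfigCongruent)
    (x : Fin N → EuclideanSpace ℝ (Fin 3)) (hx : IsStickyGroundState x) :
    ((nonBarlowCentre x).card : ℝ) ≤ 157 * 1296 * (N : ℝ) ^ ((2 : ℝ) / 3) :=
  positionalOrder_of_bulk' (bulkCrystallization3D_of_hales hL12 hcl) x hx

end Summit.Ventures.Crystal3D
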